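import Literature.MeasureTheory.Hausdorff.UniformlyDistributed
import Mathlib.Topology.MetricSpace.Bounded
import HarnessLib

/-!
# Christensen's lemma for uniformly distributed measures with finite balls (σ-finite version)

`UniformlyDistributed.lean` proves Christensen's lemma (Mattila 1995, Thm. 3.4) for *finite*
measures: two uniformly distributed finite Borel measures on a second-countable metric space are
proportional. Mattila's statement is for Radon measures all of whose balls have finite (positive)
measure, which is what the Hausdorff measure on an unbounded homogeneous set such as a round
cylinder `S^k × ℝ^{n-k}` needs (`Literature.Geometry.Riemannian.Stone1994_cylinderEntropy`). This
file proves that version: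

* `measure_le_liminf_of_measure_ball_eq'` — the one-sided Fatou inequality
  `μ U ≤ liminf_n (μ(B_{s_n})/ν(B_{s_n})) · ν U` for `s`-finite `μ, ν` (the finiteness of the
  small balls `ν(B_{s_n})` is now a hypothesis);
* `exists_eq_smul_of_measure_ball_eq_of_ne_top` — **Christensen's lemma**: if all balls have
  finite `μ`- and `ν`-measure, the ball measures do not depend on the centre, and `ν ≠ 0`, then
  `μ = c • ν` with `c < ∞` (equality first on bounded open sets, a π-system generating the Borel
  σ-algebra and containing an exhausting sequence of balls of finite measure).

## References

* P. Mattila, *Geometry of sets and measures in Euclidean spaces*, CUP 1995, Def. 3.3, Thm. 3.4.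
* J. P. R. Christensen, *On some measures analogous to Haar measure*, Math. Scand. 26 (1970).
-/

noncomputable section

open Set Filter Function Metric TopologicalSpace Bornology
open _root_.MeasureTheory _root_.MeasureTheory.Measure
open scoped ENNReal NNReal Topology

namespace Literature.MeasureTheory.Hausdorff

variable {X : Type*} [PseudoMetricSpace X] [SecondCountableTopology X] [MeasurableSpace X]
  [BorelSpace X]

/-- **Mattila's one-sided inequality, `s`-finite version.** Let `μ`, `ν` be `s`-finite measures
on a second-countable pseudometric space whose ball measures do not depend on the centre, `x₀` a
point, `s_n → 0` radii with `0 < ν (B(x₀, s_n)) < ∞`. Then for every open set `U`,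
`μ U ≤ liminf_n (μ (B(x₀, s_n)) / ν (B(x₀, s_n))) · ν U` (Mattila 1995, proof of Thm. 3.4).
[cite: Mattila1995, Thm. 3.4] -/
theorem measure_le_liminf_of_measure_ball_eq' (μ ν : Measure X) [SFinite μ] [SFinite ν]
    (hμ : ∀ (x y : X) (r : ℝ), μ (ball x r) = μ (ball y r))
    (hν : ∀ (x y : X) (r : ℝ), ν (ball x r) = ν (ball y r)) (x₀ : X) {s : ℕ → ℝ}
    (hs0 : Tendsto s atTop (𝓝 0)) (hpos : ∀ n, ν (ball x₀ (s n)) ≠ 0)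
    (hfin : ∀ n, ν (ball x₀ (s n)) ≠ ∞) {U : Set X} (hU : IsOpen U) :
    μ U ≤ liminf (fun n ↦ μ (ball x₀ (s n)) / ν (ball x₀ (s n)) * ν U) atTop := by
  -- the sets `S n = {(x, y) ∈ U × U | dist x y < s n}` and their slices
  set S : ℕ → Set (X × X) := fun n ↦ {p | p.1 ∈ U ∧ p.2 ∈ U ∧ dist p.1 p.2 < s n} with hS_def
  have hS : ∀ n, MeasurableSet (S n) := fun n ↦ by
    refine IsOpen.measurableSet ?_
    exact (hU.preimage continuous_fst).inter ((hU.preimage continuous_snd).inter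
      (isOpen_lt continuous_dist continuous_const))
  have slice₁ : ∀ n x, x ∈ U → Prod.mk x ⁻¹' S n = U ∩ ball x (s n) := fun n x hx ↦ by
    ext y
    simp only [hS_def, mem_preimage, mem_setOf_eq, mem_inter_iff, mem_ball]
    rw [dist_comm]
    tauto
  have slice₂ : ∀ n y, y ∈ U → (fun x ↦ (x, y)) ⁻¹' S n = U ∩ ball y (s n) := fun n y hy ↦ by
    ext x
    simp only [hS_def, mem_preimage, mem_setOf_eq, mem_inter_iff, mem_ball]
    tauto
  have slice₂' : ∀ n y, y ∉ U → (fun x ↦ (x, y)) ⁻¹' S n = ∅ := fun n y hy ↦ by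
    ext x
    simp only [hS_def, mem_preimage, mem_setOf_eq, mem_empty_iff_false, iff_false]
    tauto
  -- the Fatou integrands
  set f : ℕ → X → ℝ≥0∞ := fun n x ↦ ν (Prod.mk x ⁻¹' S n) * (ν (ball x₀ (s n)))⁻¹ with hf_def
  have hf : ∀ n, Measurable (f n) := fun n ↦
    (measurable_measure_prodMk_left (hS n)).mul_const _
  -- (1) lower bound: on `U`, `f n x = 1` for `n` large
  have hlow : ∀ x, U.indicator 1 x ≤ liminf (fun n ↦ f n x) atTop := by
    intro x
    by_cases hx : x ∈ U
    · rw [indicator_of_mem hx, Pi.one_apply]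
      obtain ⟨ε, hε, hεU⟩ := Metric.isOpen_iff.1 hU x hx
      have hev : ∀ᶠ n in atTop, f n x = 1 := by
        have h1 : ∀ᶠ n in atTop, s n < ε := hs0.eventually (gt_mem_nhds hε)
        filter_upwards [h1] with n hn
        have hball : U ∩ ball x (s n) = ball x (s n) :=
          inter_eq_right.2 ((ball_subset_ball hn.le).trans hεU)
        simp only [hf_def]
        rw [slice₁ n x hx, hball, hν x x₀, ENNReal.mul_inv_cancel (hpos n) (hfin n)]
      rw [liminf_congr hev, liminf_const]
    · rw [indicator_of_notMem hx]
      exact bot_le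
  -- (2) upper bound: `∫ f n dμ ≤ μ(B_{s n}) / ν(B_{s n}) * ν U`
  have hup : ∀ n, ∫⁻ x, f n x ∂μ ≤ μ (ball x₀ (s n)) / ν (ball x₀ (s n)) * ν U := by
    intro n
    have hswap : ∫⁻ x, ν (Prod.mk x ⁻¹' S n) ∂μ = ∫⁻ y, μ ((fun x ↦ (x, y)) ⁻¹' S n) ∂ν := by
      have h1 : ∀ x, ν (Prod.mk x ⁻¹' S n) = ∫⁻ y, (S n).indicator 1 (x, y) ∂ν := fun x ↦ by
        rw [← lintegral_indicator_one (measurable_prodMk_left (hS n))]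
        rfl
      have h2 : ∀ y, μ ((fun x ↦ (x, y)) ⁻¹' S n) = ∫⁻ x, (S n).indicator 1 (x, y) ∂μ :=
        fun y ↦ by
        rw [← lintegral_indicator_one (measurable_prodMk_right (hS n))]
        rfl
      simp_rw [h1, h2]
      exact lintegral_lintegral_swap ((measurable_one.indicator (hS n)).aemeasurable)
    have hbound : ∀ y, μ ((fun x ↦ (x, y)) ⁻¹' S n) ≤
        U.indicator (fun _ ↦ μ (ball x₀ (s n))) y := by
      intro y
      by_cases hy : y ∈ U
      · rw [slice₂ n y hy, indicator_of_mem hy, ← hμ y x₀ (s n)]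
        exact measure_mono inter_subset_right
      · rw [slice₂' n y hy, measure_empty]
        exact bot_le
    calc ∫⁻ x, f n x ∂μ
        = (∫⁻ x, ν (Prod.mk x ⁻¹' S n) ∂μ) * (ν (ball x₀ (s n)))⁻¹ :=
          lintegral_mul_const _ (measurable_measure_prodMk_left (hS n))
      _ ≤ (∫⁻ y, U.indicator (fun _ ↦ μ (ball x₀ (s n))) y ∂ν) * (ν (ball x₀ (s n)))⁻¹ := by
          rw [hswap]
          exact mul_le_mul' (lintegral_mono hbound) le_rfl
      _ = μ (ball x₀ (s n)) * ν U * (ν (ball x₀ (s n)))⁻¹ := by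
          rw [lintegral_indicator_const hU.measurableSet]
      _ = μ (ball x₀ (s n)) / ν (ball x₀ (s n)) * ν U := by
          rw [div_eq_mul_inv, mul_right_comm]
  -- (3) Fatou
  calc μ U = ∫⁻ x, U.indicator 1 x ∂μ := (lintegral_indicator_one hU.measurableSet).symm
    _ ≤ ∫⁻ x, liminf (fun n ↦ f n x) atTop ∂μ := lintegral_mono hlow
    _ ≤ liminf (fun n ↦ ∫⁻ x, f n x ∂μ) atTop := lintegral_liminf_le hf
    _ ≤ liminf (fun n ↦ μ (ball x₀ (s n)) / ν (ball x₀ (s n)) * ν U) atTop :=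
        liminf_le_liminf (Eventually.of_forall hup)

omit [SecondCountableTopology X] [MeasurableSpace X] [BorelSpace X] in
/-- Bounded open sets generate the Borel σ-algebra of a pseudometric space (every open set is a
countable union of bounded open sets). [folklore] -/
theorem borel_eq_generateFrom_isOpen_isBounded (x₀ : X) :
    (borel X) = MeasurableSpace.generateFrom {U : Set X | IsOpen U ∧ IsBounded U} := by
  apply le_antisymm
  · refine MeasurableSpace.generateFrom_le fun U (hU : IsOpen U) ↦ ?_
    have hUeq : U = ⋃ n : ℕ, U ∩ ball x₀ (n + 1) := by
      rw [← inter_iUnion, iUnion_ball_nat_succ, inter_univ]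
    rw [hUeq]
    exact MeasurableSet.iUnion fun n ↦ MeasurableSpace.measurableSet_generateFrom
      ⟨hU.inter isOpen_ball, isBounded_ball.subset inter_subset_right⟩
  · exact MeasurableSpace.generateFrom_le fun U hU ↦
      MeasurableSpace.measurableSet_generateFrom (hU.1 : IsOpen U)

/-- **Christensen's lemma for measures with finite balls** (Mattila 1995, Thm. 3.4). Let `μ`, `ν`
be Borel measures on a second-countable pseudometric space such that every ball has finite `μ`-
and `ν`-measure, the measures `μ (B(x, r))`, `ν (B(x, r))` do not depend on the centre `x`, and
`ν ≠ 0`. Then `μ = c • ν` for a constant `c < ∞`. Proof: along radii `s_k → 0` with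
`μ(B_{s_k})/ν(B_{s_k}) → q ∈ [0, ∞]` the one-sided inequality gives `μ U ≤ q ν U` and
`ν U ≤ q⁻¹ μ U` for bounded open `U`; testing on a ball forces `0 < q < ∞`, so `μ = q ν` on the
π-system of bounded open sets, which generates the Borel σ-algebra and exhausts the space by balls
of finite measure. [cite: Mattila1995, Thm. 3.4] -/
theorem exists_eq_smul_of_measure_ball_eq_of_ne_top (μ ν : Measure X)
    (hμ : ∀ (x y : X) (r : ℝ), μ (ball x r) = μ (ball y r))
    (hν : ∀ (x y : X) (r : ℝ), ν (ball x r) = ν (ball y r))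
    (hμfin : ∀ (x : X) (r : ℝ), μ (ball x r) ≠ ∞) (hνfin : ∀ (x : X) (r : ℝ), ν (ball x r) ≠ ∞)
    (hν0 : ν ≠ 0) : ∃ c : ℝ≥0∞, c ≠ ∞ ∧ μ = c • ν := by
  -- a base point
  have hne : Nonempty X := by
    by_contra h
    rw [not_nonempty_iff] at h
    exact hν0 (eq_zero_of_isEmpty ν)
  obtain ⟨x₀⟩ := hne
  -- both measures are σ-finite (exhaust by balls)
  haveI : SigmaFinite μ := ⟨⟨⟨fun n ↦ ball x₀ (n + 1), fun _ ↦ trivial,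
    fun n ↦ (hμfin x₀ _).lt_top, iUnion_ball_nat_succ x₀⟩⟩⟩
  haveI : SigmaFinite ν := ⟨⟨⟨fun n ↦ ball x₀ (n + 1), fun _ ↦ trivial,
    fun n ↦ (hνfin x₀ _).lt_top, iUnion_ball_nat_succ x₀⟩⟩⟩
  by_cases hμ0 : μ = 0
  · exact ⟨0, ENNReal.zero_ne_top, by rw [hμ0, zero_smul]⟩
  set g : ℝ → ℝ≥0∞ := fun r ↦ μ (ball x₀ r) with hg_def
  set h : ℝ → ℝ≥0∞ := fun r ↦ ν (ball x₀ r) with hh_def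
  have hgpos : ∀ r, 0 < r → g r ≠ 0 := fun r hr ↦
    (measure_ball_pos_of_measure_ball_eq μ hμ hμ0 x₀ hr).ne'
  have hhpos : ∀ r, 0 < r → h r ≠ 0 := fun r hr ↦
    (measure_ball_pos_of_measure_ball_eq ν hν hν0 x₀ hr).ne'
  -- radii `t n = 1/(n+1)` and a subsequence along which `g/h` converges in `[0, ∞]`
  set t : ℕ → ℝ := fun n ↦ 1 / ((n : ℝ) + 1) with ht_def
  have htpos : ∀ n, 0 < t n := fun n ↦ by positivity
  have ht0 : Tendsto t atTop (𝓝 0) := tendsto_one_div_add_atTop_nhds_zero_nat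
  obtain ⟨q, -, φ, hφ, hq⟩ := (isCompact_Icc (a := (0 : ℝ≥0∞)) (b := ⊤)).tendsto_subseq
    (x := fun n ↦ g (t n) / h (t n)) fun n ↦ ⟨bot_le, le_top⟩
  set s : ℕ → ℝ := t ∘ φ with hs_def
  have hspos : ∀ k, 0 < s k := fun k ↦ htpos _
  have hs0 : Tendsto s atTop (𝓝 0) := ht0.comp hφ.tendsto_atTop
  have hq' : Tendsto (fun k ↦ g (s k) / h (s k)) atTop (𝓝 q) := hq
  have hqinv : Tendsto (fun k ↦ h (s k) / g (s k)) atTop (𝓝 q⁻¹) := by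
    have h1 : Tendsto (fun k ↦ (g (s k) / h (s k))⁻¹) atTop (𝓝 q⁻¹) := hq'.inv
    refine h1.congr fun k ↦ ?_
    rw [ENNReal.inv_div (Or.inl (hνfin _ _)) (Or.inl (hhpos _ (hspos k)))]
  -- the two one-sided inequalities on open sets of finite measure
  have hle₁ : ∀ U : Set X, IsOpen U → ν U ≠ ∞ → μ U ≤ q * ν U := by
    intro U hU hUfin
    have hlim : Tendsto (fun k ↦ g (s k) / h (s k) * ν U) atTop (𝓝 (q * ν U)) :=
      ENNReal.Tendsto.mul_const hq' (Or.inr hUfin)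
    have := measure_le_liminf_of_measure_ball_eq' μ ν hμ hν x₀ hs0
      (fun k ↦ hhpos _ (hspos k)) (fun k ↦ hνfin _ _) hU
    rwa [hlim.liminf_eq] at this
  have hle₂ : ∀ U : Set X, IsOpen U → μ U ≠ ∞ → ν U ≤ q⁻¹ * μ U := by
    intro U hU hUfin
    have hlim : Tendsto (fun k ↦ h (s k) / g (s k) * μ U) atTop (𝓝 (q⁻¹ * μ U)) :=
      ENNReal.Tendsto.mul_const hqinv (Or.inr hUfin)
    have := measure_le_liminf_of_measure_ball_eq' ν μ hν hμ x₀ hs0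
      (fun k ↦ hgpos _ (hspos k)) (fun k ↦ hμfin _ _) hU
    rwa [hlim.liminf_eq] at this
  -- `0 < q < ∞`, testing on the unit ball
  have hq0 : q ≠ 0 := by
    intro hq0
    have h1 := hle₁ (ball x₀ 1) isOpen_ball (hνfin x₀ 1)
    rw [hq0, zero_mul, nonpos_iff_eq_zero] at h1
    exact hgpos 1 one_pos h1
  have hqtop : q ≠ ∞ := by
    intro hqt
    have h1 := hle₂ (ball x₀ 1) isOpen_ball (hμfin x₀ 1)
    rw [hqt, ENNReal.inv_top, zero_mul, nonpos_iff_eq_zero] at h1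
    exact hhpos 1 one_pos h1
  -- equality on bounded open sets
  have heq : ∀ U : Set X, IsOpen U → IsBounded U → μ U = (q • ν) U := by
    intro U hU hUb
    obtain ⟨R, hR⟩ := hUb.subset_ball x₀
    have hμU : μ U ≠ ∞ := ne_top_of_le_ne_top (hμfin x₀ R) (measure_mono hR)
    have hνU : ν U ≠ ∞ := ne_top_of_le_ne_top (hνfin x₀ R) (measure_mono hR)
    rw [Measure.smul_apply, smul_eq_mul]
    refine le_antisymm (hle₁ U hU hνU) ?_
    have h2 := hle₂ U hU hμU
    calc q * ν U ≤ q * (q⁻¹ * μ U) := by gcongr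
      _ = μ U := by rw [← mul_assoc, ENNReal.mul_inv_cancel hq0 hqtop, one_mul]
  refine ⟨q, hqtop, ?_⟩
  refine ext_of_generateFrom_of_iUnion {U : Set X | IsOpen U ∧ IsBounded U}
    (fun n ↦ ball x₀ (n + 1)) ?_ ?_ (iUnion_ball_nat_succ x₀)
    (fun n ↦ ⟨isOpen_ball, isBounded_ball⟩) (fun n ↦ hμfin x₀ _) (fun U hU ↦ heq U hU.1 hU.2)
  · rw [BorelSpace.measurable_eq (α := X)]
    exact borel_eq_generateFrom_isOpen_isBounded x₀
  · rintro U ⟨hU, hUb⟩ W ⟨hW, hWb⟩ -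
    exact ⟨hU.inter hW, hUb.subset inter_subset_left⟩

end Literature.MeasureTheory.Hausdorff

end
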